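import Summits.ValiantsHypothesis.ValiantsHypothesis.Theses.RealTau
import Summits.ValiantsHypothesis.ValiantsHypothesis.Theorems.TauReal.Negative.LoadBearing

/-!
# Crux-ideate sketch `Ideator2Sketch.lean` (ideator 2, round 1) for `RealTau.TauReal` (stmt-ValiantsHypothesis-0358)

First lemmas / rungs of the two idea cards, TYPED ONLY (they elaborate; nothing here is claimed
proved except the sanity lemmas at the end):

* card `tied-sigmoid-strip`:
  `TwoBinomialProductsPos` (the positive two-products-of-binomials rung, conjecturally `O(m)`),
  `BinomialChainBoundPos` (its divisibility-chain case — the provable rung of census T6),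
  `LogisticNetworkZeros` (the sector strengthening: untied univariate logistic networks),
* card `cumulant-multiplicity`:
  `HrubesMultiplicityForm` (Hrubeš's with-multiplicity form of the crux, roots in `ℝ ∖ {0}`;
  equivalent to `TauReal` in print), `MultiplicityAtOne` (its one-point shadow),
  `CommonBiasMultiplicity` (first lemma: common bias ⇒ multiplicity `≤ 4m + 1`, provable by the
  cumulant/Newton-identity argument of the card).
-/

set_option linter.dupNamespace false

open Polynomial Finset
open scoped BigOperators

namespace Summit.ValiantsHypothesis.ValiantsHypothesis.Cruxes.TauReal.Ideator2

open Summit.ValiantsHypothesis.ValiantsHypothesis.Theses.RealTau (TauReal RealTauRefined)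

noncomputable section

/-- The difference of two products of `m` real binomials with a COMMON shape
`∏ (X^{a j} + α j) - γ · ∏ (X^{b j} + β j)`. -/
def binomDiff {m : ℕ} (a b : Fin m → ℕ) (α β : Fin m → ℝ) (γ : ℝ) : ℝ[X] :=
  (∏ j, (X ^ (a j) + C (α j))) - C γ * ∏ j, (X ^ (b j) + C (β j))

/-- RUNG (card `tied-sigmoid-strip`; = census `BinomialPosBound`): two products of `m` binomials
with POSITIVE constant terms differ from `γ ·` one another at only `O(m)` real points.
Implied by `TauReal` (`k = 2`, `t = 2`) with `poly(m)` in place of `c·(m+1)`; Descartes gives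
`2^{m+2}`.  In log-coordinates `x = e^s` this is the statement that a TIED univariate logistic
network with `2m` units has `O(m)` sign changes. [conjecture] -/
def TwoBinomialProductsPos : Prop :=
  ∃ c : ℕ, ∀ (m : ℕ) (a b : Fin m → ℕ) (α β : Fin m → ℝ) (γ : ℝ),
    (∀ j, 0 < α j) → (∀ j, 0 < β j) → binomDiff a b α β γ ≠ 0 →
      ((binomDiff a b α β γ).roots.toFinset.filter (fun x => 0 < x)).card ≤ c * (m + 1)

/-- SECTOR STRENGTHENING `C⁺_pos` (card `tied-sigmoid-strip`, Transfer): a univariate one-hidden-layer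
LOGISTIC network with `N` units (arbitrary real output weights `c j`, positive real steepness `a j`,
centres `t j`, bias `c₀`) that is not identically zero has `O(N)` real zeros.  With `c j = ± a j ∈ ℤ`
("tied") and `x = e^s` this is `(log P - log Q)' ` for two binomial products, whence
`TwoBinomialProductsPos`; the Gaussian-unit analogue is a theorem (Schmitt 2002, Thm. 2: `≤ 2N`).
[conjecture] -/
def LogisticNetworkZeros : Prop :=
  ∃ C : ℕ, ∀ (N : ℕ) (c a t : Fin N → ℝ) (c₀ : ℝ), (∀ j, 0 < a j) →
    (∃ s : ℝ, c₀ + ∑ j, c j / (1 + Real.exp (-(a j * (s - t j)))) ≠ 0) →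
      {s : ℝ | c₀ + ∑ j, c j / (1 + Real.exp (-(a j * (s - t j)))) = 0}.ncard ≤ C * (N + 1)

/-- PROVABLE RUNG (census T6, `BinomialChainBound`): the same count, `≤ 4m + 2` POSITIVE zeros,
when all `2m` exponents lie on one divisibility chain (peeling of logistic kernels by
Pólya-frequency deconvolution; card `tied-sigmoid-strip` reinterprets the chain condition as
nesting of pole lines in the log-strip). [conjecture] -/
def BinomialChainBoundPos : Prop :=
  ∀ (m : ℕ) (a b : Fin m → ℕ) (α β : Fin m → ℝ) (γ : ℝ),
    (∀ j, 0 < α j) → (∀ j, 0 < β j) → (∀ j, 0 < a j) → (∀ j, 0 < b j) →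
    (∀ i j, a i ∣ a j ∨ a j ∣ a i) → (∀ i j, b i ∣ b j ∨ b j ∣ b i) →
    (∀ i j, a i ∣ b j ∨ b j ∣ a i) → binomDiff a b α β γ ≠ 0 →
      ((binomDiff a b α β γ).roots.toFinset.filter (fun x => 0 < x)).card ≤ 4 * m + 2

/-- TRANSFER TARGET `C⁺` (card `cumulant-multiplicity`): Hrubeš's WITH-MULTIPLICITY form of the
real τ-conjecture — the real roots in `ℝ ∖ {0}` of a nonzero ΣΠ-sparse `F`, COUNTED WITH
MULTIPLICITY, number at most `(k + m + t + 2)^c`.  Equivalent to `TauReal` in print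
(Hrubeš 2013, Thm. 2.3 with Conj. 2.1); the root `0` must be excluded
(`Negative.not_tauRealMultiplicity`: `X^n`). [cite: Hrubes2013, Conj. 2.1] -/
def HrubesMultiplicityForm : Prop :=
  ∃ c : ℕ, ∀ (k m t : ℕ) (f : Fin k → Fin m → ℝ[X]), (∀ i j, (f i j).support.card ≤ t) →
    (∑ i, ∏ j, f i j) ≠ 0 →
      Multiset.card ((∑ i, ∏ j, f i j).roots.filter (fun x => x ≠ 0)) ≤ (k + m + t + 2) ^ c

/-- ONE-POINT SHADOW of `C⁺` (stage 1 of card `cumulant-multiplicity`): the order of vanishing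
at `x = 1` of a nonzero ΣΠ-sparse polynomial is polynomial in `k, m, t` (Hajós gives only
`k t^m - 1`; census N2's refutation surface).  A consequence of `TauReal`. [conjecture] -/
def MultiplicityAtOne : Prop :=
  ∃ c : ℕ, ∀ (k m t : ℕ) (f : Fin k → Fin m → ℝ[X]), (∀ i j, (f i j).support.card ≤ t) →
    (∑ i, ∏ j, f i j) ≠ 0 → (∑ i, ∏ j, f i j).rootMultiplicity 1 ≤ (k + m + t + 2) ^ c

/-- FIRST LEMMA of card `cumulant-multiplicity` (provable; cumulant linearisation + Newton's
identities + simplicity of the roots of the derivative polynomials of the logistic function):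
with a COMMON bias `α ≠ -1` in all `2m` binomials, `∏ (X^{a j} + α) - γ ∏ (X^{b j} + α)`
vanishes at `1` to order at most `4m + 1`. [folklore] -/
def CommonBiasMultiplicity : Prop :=
  ∀ (m : ℕ) (a b : Fin m → ℕ) (α γ : ℝ), α ≠ -1 →
    binomDiff a b (fun _ => α) (fun _ => α) γ ≠ 0 →
      (binomDiff a b (fun _ => α) (fun _ => α) γ).rootMultiplicity 1 ≤ 4 * m + 1

/-- The two-products rung with multiplicity (stage-1 rung restricted to `k = t = 2`): order of
vanishing at `1` of `∏ (X^{a j} + α j) - γ ∏ (X^{b j} + β j)` is `O(m)`; census N2 data: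
generic `2m + 1`, sporadic `2m + 2` at `m = 2`. [conjecture] -/
def TwoBinomialProductsMultiplicity : Prop :=
  ∃ c : ℕ, ∀ (m : ℕ) (a b : Fin m → ℕ) (α β : Fin m → ℝ) (γ : ℝ),
    binomDiff a b α β γ ≠ 0 → (binomDiff a b α β γ).rootMultiplicity 1 ≤ c * (m + 1)

/-! ### Sanity: the statements are not vacuous in the trivial corners -/

/-- `m = 0`: `binomDiff` is the constant `1 - γ`. -/
theorem binomDiff_zero (a b : Fin 0 → ℕ) (α β : Fin 0 → ℝ) (γ : ℝ) :
    binomDiff a b α β γ = C (1 - γ) := by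
  simp [binomDiff, map_sub]

/-- The with-multiplicity form implies the crux's distinct-root count away from `0`
(`toFinset` only drops repetitions). [folklore] -/
theorem card_toFinset_filter_le_of_hrubes {F : ℝ[X]} :
    (F.roots.toFinset.filter (fun x => x ≠ 0)).card ≤
      Multiset.card (F.roots.filter (fun x => x ≠ 0)) := by
  rw [← Multiset.toFinset_filter]
  exact Multiset.toFinset_card_le _

end

end Summit.ValiantsHypothesis.ValiantsHypothesis.Cruxes.TauReal.Ideator2
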